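import Mathlib
import Summits.KontsevichZagierPeriods.Zeta5Search.WedgeDictionaryCells
import Summits.KontsevichZagierPeriods.Zeta5Search.Elimination.ThreeTermClosure
import HarnessLib

/-!
# ζ(5) search — Elimination: the THIN cellular interface of the D2 descent — `explicitPQ` is EQUIVALENT to
# STAR on the zero-slot strata + PENCIL at one slot + the terminal values

HONEST FRAMING: systematic search; no irrationality claim unless certified.  Cell `pub-zeta5`, family-designer
class `elim`, fam-elim gen 28 (2026-08-21).  Bookkeeping on gen-1's descent with the dictionary nodes discharged
(`Elimination.dictStar_holds`, `Elimination.dictPencil_holds`); the cellular inputs below are HYPOTHESES (instances of the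
`@[conjecture]` nodes `CellStar`, `CellPencil`), none is proved here; nothing about `ζ(5)`; no number of record moves.

WHAT.  E-L25's `Elimination.explicitPQ_of_cells : CellStar → CellPencil → (terminal values) → explicitPQ` consumes its two
cellular families only on thin loci (read off the proof of `Elimination.explicitPQAt_level_of_provider`):
* STAR only at NON-INTERIOR region points (some slot `b_i = 0`), for ONE pair `p, q` of non-zero slots with
  `b_p ≠ b_q`, all three points with the same partner index — `CellStarZero`;
* PENCIL only at INTERIOR points and, now that `DictPencil` is a theorem, at ONE FIXED slot `s₀` — `CellPencilSlot s₀`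
  (`Elimination/ThreeTermClosure`).
This file re-runs the descent on exactly these inputs (`explicitPQ_of_thin_cells`) and records the converse, so that
  `explicitPQ ↔ CellStarZero ∧ CellPencilSlot s₀ ∧ TerminalValues`   (`explicitPQ_iff_thin`, any `s₀ ∈ {1,…,7}`)
is the exact cellular content CONSUMED BY THE DESCENT; and gen-1's D2 end statement `WedgeDictionary.Rows.explicitPQ_iff_cells4`
(`explicitPQ ↔ CellStar ∧ CellPencil ∧ CellBridge ∧` four level-1 data, under the Brown–Zudilin invariance) holds with
`CellPencil` replaced by ONE slot family `CellPencilSlot s₀` (`explicitPQ_iff_cells4_slot`; the other six slots follow from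
`CellStar` by the `K₈` closure of `Elimination/ThreeTermClosure`).  EXACT CENSUS (fam-elim g28 `CLOSURE-CENSUS.md`, levels
`b₀ ≤ 7`: 79 335 region points, 11 752 interior, 1 571 terminal, 66 012 STAR-step points): every one of the 21 slot pairs
occurs as the ONLY admissible pair at some point with two non-zero slots, so `CellStarZero` cannot be thinned by pair
inside this descent; `CellPencilSlot` is one family out of seven.
-/

open Finset

namespace Summit.KontsevichZagierPeriods.Zeta5Search.Elimination

open Summit.KontsevichZagierPeriods.Zeta5Search.WedgeDictionary
open Literature.NumberTheory.Irrationality.BrownZudilin2022 (bOfA cellularIntegral invariance_of_converges')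

/-! ## 1. The thin cellular STAR node and the terminal-values hypothesis -/

/-- **STAR on the zero-slot strata** (a WEAKENING of the conjecture node `CellStar`, NOT proved here): at a region point
with some slot zero, for non-zero slots `p, q` of different values, the cellular STAR(p,q) relation (one partner index). -/
def CellStarZero : Prop :=
  ∀ (a : Fin 8 → ℤ) (p q j : ℕ), p ∈ Icc 1 7 → q ∈ Icc 1 7 → RegionHyp a j → (∃ i ∈ Icc 1 7, bOfA a i = 0) →
    1 ≤ bOfA a p → 1 ≤ bOfA a q → bOfA a p ≠ bOfA a q →
      ThreeTermRel (starKappa (bOfA a) p q) (-fanCoeff (bOfA a) q) (fanCoeff (bOfA a) p) a (a + slotDown q)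
        (a + slotDown p)

/-- **Terminal values** (gen-1's interface, the third input of `explicitPQ_of_cells`): `explicitPQ` at every terminal
region point, given it at all points of lower level (a hypothesis schema, NOT proved here). -/
def TerminalValues : Prop :=
  ∀ (a : Fin 8 → ℤ) (j : ℕ), Terminal a → RegionHyp a j →
    (∀ (c : Fin 8 → ℤ) (j' : ℕ), bOfA c 0 < bOfA a 0 → RegionHyp c j' → ExplicitPQAt c j') → ExplicitPQAt a j

/-- `CellStar` implies its zero-strata restriction. -/
theorem cellStarZero_of_cellStar (h : CellStar) : CellStarZero := by
  intro a p q j hp hq hr _ hp1 hq1 hne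
  have hpq : p ≠ q := by rintro rfl; exact hne rfl
  exact h a p q j j j hp hq hpq hr (regionHyp_slotDown hr hq hq1) (regionHyp_slotDown hr hp hp1)

/-- `CellPencil` implies each slot family. -/
theorem cellPencilSlot_of_cellPencil (h : CellPencil) {s : ℕ} (hs : s ∈ Icc 1 7) : CellPencilSlot s :=
  (cellPencil_iff_slots.1 h) s hs

/-! ## 2. The two descent steps on the thin inputs -/

/-- **STAR descent step from `CellStarZero`** (gen-1's `descent_star` with `DictStar` discharged and the cellular input
restricted to the zero-slot strata). -/
theorem descent_star_zero (hcS : CellStarZero) {a : Fin 8 → ℤ} {j p q : ℕ} (hr : RegionHyp a j) (hp : p ∈ Icc 1 7)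
    (hq : q ∈ Icc 1 7) (hz : ∃ i ∈ Icc 1 7, bOfA a i = 0) (hp1 : 1 ≤ bOfA a p) (hq1 : 1 ≤ bOfA a q)
    (hne : bOfA a p ≠ bOfA a q) (h₁ : ExplicitPQAt (a + slotDown q) j) (h₂ : ExplicitPQAt (a + slotDown p) j) :
    ExplicitPQAt a j := by
  have hpq : p ≠ q := by rintro rfl; exact hne rfl
  have r₁ : RegionHyp (a + slotDown q) j := regionHyp_slotDown hr hq hq1
  have r₂ : RegionHyp (a + slotDown p) j := regionHyp_slotDown hr hp hp1
  have hrel := hcS a p q j hp hq hr hz hp1 hq1 hne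
  have hdic := dictStar_holds a p q j j j hp hq hpq hr r₁ r₂
  have hbp := hr.2.2.1 p hp
  have hbq := hr.2.2.1 q hq
  have hα : ((starKappa (bOfA a) p q : ℤ) : ℚ) ≠ 0 := by
    have hne' : starKappa (bOfA a) p q ≠ 0 := by
      unfold starKappa
      exact mul_ne_zero (sub_ne_zero.2 hne) (by omega)
    exact_mod_cast hne'
  exact at_first_of_threeTerm hrel hdic h₁ h₂ hα

/-- **PENCIL descent step at the fixed slot `s₀` from `CellPencilSlot s₀`** (E-L23's `descent_pencil_slot` with the
dictionary instance taken from `dictPencil_holds`). -/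
theorem descent_pencil_thin {s₀ : ℕ} (hs₀ : s₀ ∈ Icc 1 7) (hcP : CellPencilSlot s₀) {a : Fin 8 → ℤ} {j : ℕ}
    (hr : RegionHyp a j) (hpos : ∀ m ∈ Icc 1 7, 1 ≤ bOfA a m) (h₀ : ExplicitPQAt (a - dsUp) j)
    (h₂ : ExplicitPQAt (a + slotDown s₀) j) : ExplicitPQAt a j := by
  have hs' := (mem_Icc.1 hs₀)
  have hca : a - dsUp + dsUp = a := sub_add_cancel a dsUp
  have r₀ : RegionHyp (a - dsUp) j := regionHyp_sub_dsUp hr hpos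
  have r₁ : RegionHyp (a - dsUp + dsUp) j := by rw [hca]; exact hr
  have r₂ : RegionHyp (a - dsUp + dsUp + slotDown s₀) j := by
    rw [hca]; exact regionHyp_slotDown hr hs₀ (hpos s₀ hs₀)
  have hrel := hcP (a - dsUp) j j j r₀ r₁ r₂
  have hdic := dictPencil_holds (a - dsUp) s₀ j j j hs₀ r₀ r₁ r₂
  have hbi := hr.2.2.1 s₀ hs₀
  have hpi := hpos s₀ hs₀
  have hβ : ((pencilApex (bOfA (a - dsUp)) s₀ : ℤ) : ℚ) ≠ 0 := by
    have hne : pencilApex (bOfA (a - dsUp)) s₀ ≠ 0 := by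
      unfold pencilApex
      rw [bOfA_sub_dsUp a s₀ hs'.2, bOfA_sub_dsUp a 0 (by norm_num), if_neg (by omega), if_pos rfl]
      exact mul_ne_zero (by omega) (by omega)
    exact_mod_cast hne
  have h := at_mid_of_threeTerm' hrel hdic h₀ (by rw [hca]; exact h₂) hβ
  rw [hca] at h
  exact h

/-! ## 3. The descent on the thin inputs -/

/-- **Level descent on the thin inputs**: `explicitPQ` at level `N − 2` and at the terminal points of level `N` give it
on level `N` (inner induction on the slot sum; PENCIL at slot `s₀` on the interior, STAR on the zero-slot strata). -/
theorem explicitPQAt_level_of_thin {s₀ : ℕ} (hs₀ : s₀ ∈ Icc 1 7) (hcS : CellStarZero) (hcP : CellPencilSlot s₀) {N : ℤ}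
    (hlow : ∀ (c : Fin 8 → ℤ) (j : ℕ), bOfA c 0 = N - 2 → RegionHyp c j → ExplicitPQAt c j)
    (hterm : ∀ (a : Fin 8 → ℤ) (j : ℕ), bOfA a 0 = N → Terminal a → RegionHyp a j → ExplicitPQAt a j) :
    ∀ (a : Fin 8 → ℤ) (j : ℕ), bOfA a 0 = N → RegionHyp a j → ExplicitPQAt a j := by
  suffices H : ∀ s : ℕ, ∀ (a : Fin 8 → ℤ) (j : ℕ), bOfA a 0 = N → RegionHyp a j → (slotSum a).toNat = s →
      ExplicitPQAt a j from fun a j hN hr => H _ a j hN hr rfl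
  intro s
  induction s using Nat.strong_induction_on with
  | _ s ih =>
    intro a j hN hr hs
    have hbox := hr.2.2.1
    have hb1 := hbox 1 (by simp)
    have hb2 := hbox 2 (by simp)
    have hb3 := hbox 3 (by simp)
    have hb4 := hbox 4 (by simp)
    have hb5 := hbox 5 (by simp)
    have hb6 := hbox 6 (by simp)
    have hb7 := hbox 7 (by simp)
    have hss : 0 ≤ slotSum a := by
      simp only [slotSum]
      omega
    have hs1 : 1 ≤ s₀ := (mem_Icc.1 hs₀).1
    by_cases hpos : ∀ i ∈ Icc 1 7, 1 ≤ bOfA a i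
    · -- interior: PENCIL step at slot `s₀`, base `a − DS` (level `N − 2`), third point `a − s_{s₀}`
      have h₀ : ExplicitPQAt (a - dsUp) j :=
        hlow (a - dsUp) j (by rw [bOfA_sub_dsUp a 0 (by norm_num), if_pos rfl, hN]) (regionHyp_sub_dsUp hr hpos)
      have hge : bOfA a s₀ ≤ slotSum a := le_slotSum hr hs₀
      have hpi := hpos s₀ hs₀
      have hlt : (slotSum (a + slotDown s₀)).toNat < s := by
        rw [slotSum_add_slotDown a hs₀]
        omega
      have hN' : bOfA (a + slotDown s₀) 0 = N := by
        rw [bOfA_add_slotDown a s₀ hs₀ 0 (by norm_num), if_neg (by omega)]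
        exact hN
      have h₂ : ExplicitPQAt (a + slotDown s₀) j :=
        ih _ hlt (a + slotDown s₀) j hN' (regionHyp_slotDown hr hs₀ hpi) rfl
      exact descent_pencil_thin hs₀ hcP hr hpos h₀ h₂
    · push Not at hpos
      obtain ⟨i₀, hi₀, hz⟩ := hpos
      have hz0 : ∃ i ∈ Icc 1 7, bOfA a i = 0 := ⟨i₀, hi₀, by have := hbox i₀ hi₀; omega⟩
      by_cases hdis : ∃ p ∈ Icc 1 7, ∃ q ∈ Icc 1 7, bOfA a p ≠ 0 ∧ bOfA a q ≠ 0 ∧ bOfA a p ≠ bOfA a q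
      · -- zero-slot stratum, non-terminal: STAR step at a pair of non-zero slots with different values
        obtain ⟨p, hp, q, hq, hp0, hq0, hpq⟩ := hdis
        have hp1 : 1 ≤ bOfA a p := by
          have := hbox p hp
          omega
        have hq1 : 1 ≤ bOfA a q := by
          have := hbox q hq
          omega
        have hp' : 1 ≤ p := (mem_Icc.1 hp).1
        have hq' : 1 ≤ q := (mem_Icc.1 hq).1
        have hNq : bOfA (a + slotDown q) 0 = N := by
          rw [bOfA_add_slotDown a q hq 0 (by norm_num), if_neg (show (0 : ℕ) ≠ q by omega)]
          exact hN
        have hNp : bOfA (a + slotDown p) 0 = N := by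
          rw [bOfA_add_slotDown a p hp 0 (by norm_num), if_neg (show (0 : ℕ) ≠ p by omega)]
          exact hN
        have hgeq : bOfA a q ≤ slotSum a := le_slotSum hr hq
        have hltq : (slotSum (a + slotDown q)).toNat < s := by
          rw [slotSum_add_slotDown a hq]
          omega
        have hltp : (slotSum (a + slotDown p)).toNat < s := by
          rw [slotSum_add_slotDown a hp]
          have hgep : bOfA a p ≤ slotSum a := le_slotSum hr hp
          omega
        have h₁ : ExplicitPQAt (a + slotDown q) j :=
          ih _ hltq (a + slotDown q) j hNq (regionHyp_slotDown hr hq hq1) rfl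
        have h₂ : ExplicitPQAt (a + slotDown p) j :=
          ih _ hltp (a + slotDown p) j hNp (regionHyp_slotDown hr hp hp1) rfl
        exact descent_star_zero hcS hr hp hq hz0 hp1 hq1 hpq h₁ h₂
      · -- terminal
        have hT : Terminal a := by
          refine ⟨hz0, ?_⟩
          intro p hp q hq hp0 hq0
          by_contra hne
          exact hdis ⟨p, hp, q, hq, hp0, hq0, hne⟩
        exact hterm a j hN hT hr

/-- **`explicitPQ` FROM THE THIN CELLULAR INPUTS (PROVED REDUCTION).** STAR on the zero-slot strata, PENCIL at one slot
`s₀` on the interior, and the terminal values give Brown–Zudilin's `explicitPQ` (the dictionary side being discharged). -/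
theorem explicitPQ_of_thin_cells {s₀ : ℕ} (hs₀ : s₀ ∈ Icc 1 7) (hcS : CellStarZero) (hcP : CellPencilSlot s₀)
    (hterm : TerminalValues) : explicitPQ := by
  rw [explicitPQ_iff_at]
  suffices H : ∀ n : ℕ, ∀ (a : Fin 8 → ℤ) (j : ℕ), (bOfA a 0).toNat = n → RegionHyp a j → ExplicitPQAt a j from
    fun a j hr => H _ a j rfl hr
  intro n
  induction n using Nat.strong_induction_on with
  | _ n ih =>
    intro a j hn hr
    have hN0 : 0 ≤ bOfA a 0 := level_nonneg hr
    refine explicitPQAt_level_of_thin hs₀ hcS hcP (N := bOfA a 0) ?_ ?_ a j rfl hr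
    · intro c j' hc hr'
      have hc0 : 0 ≤ bOfA c 0 := level_nonneg hr'
      have hlt : (bOfA c 0).toNat < n := by
        rw [← hn]
        omega
      exact ih _ hlt c j' rfl hr'
    · intro a' j' _ hT hr'
      refine hterm a' j' hT hr' ?_
      intro c j'' hlt' hrc
      have hc0 : 0 ≤ bOfA c 0 := level_nonneg hrc
      exact ih _ (by omega) c j'' rfl hrc

/-- The same with gen-1's full `CellStar` and PENCIL at one slot (E-L25's `explicitPQ_of_cells` needs `CellPencil` at
one slot only). -/
theorem explicitPQ_of_cellStar_pencilSlot {s₀ : ℕ} (hs₀ : s₀ ∈ Icc 1 7) (hcS : CellStar) (hcP : CellPencilSlot s₀)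
    (hterm : TerminalValues) : explicitPQ :=
  explicitPQ_of_thin_cells hs₀ (cellStarZero_of_cellStar hcS) hcP hterm

/-! ## 4. The converse: the thin inputs are consequences of `explicitPQ` -/

/-- `explicitPQ` gives STAR on the zero-slot strata (via `cellStar_of_explicitPQ'`). -/
theorem cellStarZero_of_explicitPQ (h : explicitPQ) : CellStarZero :=
  cellStarZero_of_cellStar (cellStar_of_explicitPQ' h)

/-- `explicitPQ` gives every PENCIL slot family (via `cellPencil_of_explicitPQ'`). -/
theorem cellPencilSlot_of_explicitPQ (h : explicitPQ) {s : ℕ} (hs : s ∈ Icc 1 7) : CellPencilSlot s :=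
  cellPencilSlot_of_cellPencil (cellPencil_of_explicitPQ' h) hs

/-- **THE THIN INTERFACE IS EXACT.** For any slot `s₀ ∈ {1,…,7}`:
`explicitPQ ↔ CellStarZero ∧ CellPencilSlot s₀ ∧ TerminalValues`. -/
theorem explicitPQ_iff_thin {s₀ : ℕ} (hs₀ : s₀ ∈ Icc 1 7) :
    explicitPQ ↔ CellStarZero ∧ CellPencilSlot s₀ ∧ TerminalValues :=
  ⟨fun h => ⟨cellStarZero_of_explicitPQ h, cellPencilSlot_of_explicitPQ h hs₀, terminal_of_explicitPQ h⟩,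
    fun h => explicitPQ_of_thin_cells hs₀ h.1 h.2.1 h.2.2⟩

/-- In particular the full families are equivalent to the thin ones given the terminal values:
`CellStar ∧ CellPencil ∧ TerminalValues ↔ CellStarZero ∧ CellPencilSlot 1 ∧ TerminalValues`. -/
theorem cells_iff_thin : CellStar ∧ CellPencil ∧ TerminalValues ↔ CellStarZero ∧ CellPencilSlot 1 ∧ TerminalValues := by
  have h1 : (1 : ℕ) ∈ Icc 1 7 := by simp
  constructor
  · rintro ⟨hS, hP, hT⟩
    exact ⟨cellStarZero_of_cellStar hS, cellPencilSlot_of_cellPencil hP h1, hT⟩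
  · intro h
    have he : explicitPQ := (explicitPQ_iff_thin h1).2 h
    exact ⟨cellStar_of_explicitPQ' he, cellPencil_of_explicitPQ' he, h.2.2⟩

/-! ## 5. gen-1's D2 end statement with PENCIL at one slot -/

/-- **gen-1's D2 end statement (`WedgeDictionary.Rows.explicitPQ_iff_cells4`) with the PENCIL family at ONE slot**: under the
Brown–Zudilin invariance, `explicitPQ` is equivalent to `CellStar`, `CellPencilSlot s₀` (any one slot), `CellBridge` and the
four level-1 instances — the other six PENCIL slots follow from `CellStar` by the `K₈` closure
(`cellPencil_of_slot_of_cellStar`). -/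
theorem explicitPQ_iff_cells4_slot (hInv : invariance_of_converges') {s₀ : ℕ} (hs₀ : s₀ ∈ Icc 1 7) :
    explicitPQ ↔
      (CellStar ∧ CellPencilSlot s₀ ∧ CellBridge ∧ ExplicitPQAt ![1, 0, 1, 0, 1, 1, 1, 1] 1 ∧
        ExplicitPQAt ![0, 0, 1, 0, 1, 1, 1, 1] 2 ∧ ExplicitPQAt ![0, 0, 1, 0, 1, 0, 0, 1] 2 ∧
          ExplicitPQAt ![0, 0, 1, 0, 1, 1, 0, 1] 2) := by
  rw [Rows.explicitPQ_iff_cells4 hInv]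
  constructor
  · rintro ⟨hS, hP, rest⟩
    exact ⟨hS, cellPencilSlot_of_cellPencil hP hs₀, rest⟩
  · rintro ⟨hS, hP, rest⟩
    exact ⟨hS, cellPencil_of_slot_of_cellStar hs₀ hP hS, rest⟩

end Summit.KontsevichZagierPeriods.Zeta5Search.Elimination
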